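import Summits.QuantumFields.YangMills.Theorems.BalabanUVNodesN15KingModelFullPropagatorProfile

/-!
# BalabanUVNodes ∕ N15 — THE KING-MODEL RUNG, CURVED EDITION (PART T-a): TORUS WALKS — the short arc in each coordinate, the coordinate walk
# inside the sup-ball, and telescoping along it (`|F(x′) − F(x)| ≤ dd·|x − x′|_K·B` when every lattice step in the ball costs `≤ B`)
# (Track A, DAG node N15 = NE2; FAN-OUT v1.1 §N15 s3 «KING-MODEL RUNG …»; the geometric input of part T-b's Hölder clause (3.65) ∕ (3.8))

HONEST FRAMING.  Count-neutral kernel bookkeeping (cell `pub-ymgap`, seat `pub-ymgap-dag-n15-e` g8; `--supports stmt-QuantumFields-20296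
--as helper` = K3⁵ `SpineGivenEndpointR13SepCoP`, WORDS-141).  Pure finite-torus geometry on `Tor K = Π_μ ℤ∕K_μ` with the sup circular distance
`King1986.Torus.tdistT` (the currency of every kernel estimate of this rung); [folklore].  Context: King's Hölder derivative (3.62) p. 663
`(∂_α(x, y)G)(z) = |x − y|^{−α}{G(x, z) − G(y, z)}` compares a kernel at two ARBITRARY points; the tree's gradient bounds (part R-c) control ONE
lattice step; passing from one to the other on the TORUS needs a walk along the SHORT arcs (the long way round a period leaves every ball).
Nothing here is specific to King's operators; nothing continuum ∕ ℝ⁴ ∕ OS ∕ mass-gap ∕ Clay.  0 `sorry`, 0 `def`, standard axioms.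

WHAT IS PROVED (generic periods `K : Fin dd → ℕ`, all `≥ 1`):
* `add_single_succ` (`x + (s+1)·e_j = (x + s·e_j) + e_j`), ★ **`abs_sub_le_of_unit_steps`** (telescoping along one direction: `t` steps of cost `≤ B`
  give `|F(w + t·e_j) − F(w)| ≤ t·B`);
* `circAbs_val_sub_add_natCast_le` (`dist(a, a + s) ≤ s` on `ℤ∕nℤ`), `circAbs_val_add_sub_add_le` (`dist(b + t, b + s) ≤ t − s`);
* ★ **`exists_short_arc`** — for `x, x′` and a direction `j` there is `t ≤ |x − x′|_K` with `x′_j = x_j + t` OR `x_j = x′_j + t` on `ℤ∕K_jℤ` (the two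
  residues `(x′_j − x_j).val`, `(x_j − x′_j).val` sum to `0` or `K_j` — `ZMod.val_add` — and the circular distance `circAbs` is the smaller one,
  read through `ZMod.val_intCast`);
* `tdistT_le_of_coords_near` (a point each of whose coordinates is `x_ν`, `x′_ν` or within `|x − x′|_K` of `x_ν` lies in the sup-ball of radius
  `|x − x′|_K` around `x`);
* ★★ **`abs_sub_le_of_ball_steps`** — `|F(x′) − F(x)| ≤ dd·|x − x′|_K·B` for EVERY `F : Tor K → ℝ` whose lattice steps inside the sup-ball of radius
  `|x − x′|_K` around `x` cost at most `B`: the coordinate walk `W j` (first `j` coordinates moved to `x′`) proceeds along the short arcs, every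
  intermediate point stays in the ball, each coordinate costs `≤ |x − x′|_K` steps.
Locators: [King1986] C. King, CMP **102** (1986) 649–677: (2.10) p. 653 (the torus `T_η`), (3.62) p. 663.
-/

noncomputable section

namespace Summit.QuantumFields.YangMills.BalabanUVNodes.N15KingModelRung.Curved

open Real Finset Matrix
open Literature.MathematicalPhysics.QuantumFieldTheory.Balaban1983to89.B5Prop11Plancherel (Tor fine unitVec)
open Literature.MathematicalPhysics.QuantumFieldTheory.Balaban1983to89.B4TorusKernel.MultiPeriod (circAbs circAbs_add_mul
  circAbs_le_abs circAbs_nonneg)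
open Literature.MathematicalPhysics.QuantumFieldTheory.King1986.Torus (tdistT toSite circAbs_le_tdistT tdistT_le_of_coord
  one_le_period tdistT_nonneg tdistT_triangle tdistT_symm)

/-! ## §1 Torus path geometry: short arcs, the coordinate walk, telescoping -/

section PathGeometry

variable {dd : ℕ} (K : Fin dd → ℕ) [∀ μ, NeZero (K μ)]

omit [∀ μ, NeZero (K μ)] in
/-- One more step: `x + (s+1)·e_j = (x + s·e_j) + e_j`. [folklore] -/
theorem add_single_succ (x : Tor K) (j : Fin dd) (s : ℕ) :
    x + Pi.single j (((s + 1 : ℕ)) : ZMod (K j)) = (x + Pi.single j ((s : ℕ) : ZMod (K j))) + unitVec K j := by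
  rw [unitVec, add_assoc, ← Pi.single_add, Nat.cast_succ]

omit [∀ μ, NeZero (K μ)] in
/-- **Telescoping along one lattice direction**: if every unit step `w + s·e_j → w + (s+1)·e_j`, `s < t`, changes `F` by at most `B`, then
`|F(w + t·e_j) − F(w)| ≤ t·B`. [folklore] -/
theorem abs_sub_le_of_unit_steps (F : Tor K → ℝ) (w : Tor K) (j : Fin dd) (B : ℝ) (t : ℕ)
    (h : ∀ s : ℕ, s < t → |F (w + Pi.single j (((s + 1 : ℕ)) : ZMod (K j))) - F (w + Pi.single j ((s : ℕ) : ZMod (K j)))| ≤ B) :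
    |F (w + Pi.single j ((t : ℕ) : ZMod (K j))) - F w| ≤ t * B := by
  induction t with
  | zero => simp
  | succ t ih =>
    have h1 := ih (fun s hs => h s (Nat.lt_succ_of_lt hs))
    have h2 := h t (Nat.lt_succ_self t)
    calc |F (w + Pi.single j (((t + 1 : ℕ)) : ZMod (K j))) - F w|
        = |(F (w + Pi.single j (((t + 1 : ℕ)) : ZMod (K j))) - F (w + Pi.single j ((t : ℕ) : ZMod (K j))))
            + (F (w + Pi.single j ((t : ℕ) : ZMod (K j))) - F w)| := by ring_nf
      _ ≤ |F (w + Pi.single j (((t + 1 : ℕ)) : ZMod (K j))) - F (w + Pi.single j ((t : ℕ) : ZMod (K j)))|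
            + |F (w + Pi.single j ((t : ℕ) : ZMod (K j))) - F w| := abs_add_le _ _
      _ ≤ B + t * B := add_le_add h2 h1
      _ = ((t + 1 : ℕ) : ℝ) * B := by push_cast; ring

/-- The circular displacement of `s` forward steps is at most `s`: `dist(a, a + s) ≤ s` on `ℤ∕K_jℤ`. [folklore] -/
theorem circAbs_val_sub_add_natCast_le (j : Fin dd) (a : ZMod (K j)) (s : ℕ) :
    circAbs (K j) ((a.val : ℤ) - (((a + ((s : ℕ) : ZMod (K j))).val : ℕ) : ℤ)) ≤ s := by
  have hn1 : 1 ≤ K j := one_le_period K j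
  -- `(a + s).val ≡ a.val + s (mod n)`
  have hmod : Nat.ModEq (K j) (a + ((s : ℕ) : ZMod (K j))).val (a.val + s) := by
    rw [ZMod.val_add, ZMod.val_natCast]
    exact (Nat.mod_modEq _ (K j)).trans (Nat.ModEq.add_left _ (Nat.mod_modEq s (K j)))
  obtain ⟨q, hq⟩ := (Nat.modEq_iff_dvd.mp hmod)
  have hrepr : (a.val : ℤ) - (((a + ((s : ℕ) : ZMod (K j))).val : ℕ) : ℤ) = -(s : ℤ) + (K j) * q := by
    push_cast at hq ⊢
    linarith
  rw [hrepr, circAbs_add_mul]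
  calc circAbs (K j) (-(s : ℤ)) ≤ |(-(s : ℤ))| := circAbs_le_abs hn1 _
    _ = s := by simp

/-- A shifted coordinate moved back: `dist(b + t, b + s) ≤ t − s` for `s ≤ t`. [folklore] -/
theorem circAbs_val_add_sub_add_le (j : Fin dd) (b : ZMod (K j)) {s t : ℕ} (hst : s ≤ t) :
    circAbs (K j) ((((b + ((t : ℕ) : ZMod (K j))).val : ℕ) : ℤ) - (((b + ((s : ℕ) : ZMod (K j))).val : ℕ) : ℤ)) ≤ (t - s : ℕ) := by
  have h := circAbs_val_sub_add_natCast_le K j (b + ((s : ℕ) : ZMod (K j))) (t - s)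
  have he : b + ((s : ℕ) : ZMod (K j)) + (((t - s : ℕ)) : ZMod (K j)) = b + ((t : ℕ) : ZMod (K j)) := by
    rw [add_assoc, ← Nat.cast_add, Nat.add_sub_cancel' hst]
  rw [he] at h
  -- `circAbs` is symmetric under `z ↦ −z`
  have hsymm := Literature.MathematicalPhysics.QuantumFieldTheory.Balaban1983to89.B4Sect5Torus.circAbs_neg (one_le_period K j)
    ((((b + ((s : ℕ) : ZMod (K j))).val : ℕ) : ℤ) - (((b + ((t : ℕ) : ZMod (K j))).val : ℕ) : ℤ))
  rw [neg_sub] at hsymm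
  rw [hsymm]
  exact h

/-- **The signed short arc in one coordinate**: between two points `x, x′` of the torus and a direction `j` there is `t ≤ |x − x′|_K` (the sup
torus distance) such that either `x′_j = x_j + t` or `x_j = x′_j + t` on `ℤ∕K_jℤ` (move forward from the nearer end). [folklore] -/
theorem exists_short_arc (x x' : Tor K) (j : Fin dd) :
    ∃ t : ℕ, (t : ℝ) ≤ tdistT K x x' ∧ (x' j = x j + ((t : ℕ) : ZMod (K j)) ∨ x j = x' j + ((t : ℕ) : ZMod (K j))) := by
  have hn1 : 1 ≤ K j := one_le_period K j
  set dp : ℕ := (x' j - x j).val with hdp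
  set dm : ℕ := (x j - x' j).val with hdm
  have hfwd : x' j = x j + ((dp : ℕ) : ZMod (K j)) := by rw [hdp, ZMod.natCast_zmod_val]; ring
  have hbwd : x j = x' j + ((dm : ℕ) : ZMod (K j)) := by rw [hdm, ZMod.natCast_zmod_val]; ring
  -- `dm = (a.val − b.val) mod n` and `dp + dm ∈ {0, n}`
  have hz : ((((x j).val : ℤ) - ((x' j).val : ℤ) : ℤ) : ZMod (K j)) = x j - x' j := by
    push_cast
    rw [ZMod.natCast_zmod_val, ZMod.natCast_zmod_val]
  have hdm' : ((dm : ℕ) : ℤ) = (((x j).val : ℤ) - ((x' j).val : ℤ)) % ((K j : ℕ) : ℤ) := by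
    rw [hdm, ← hz, ZMod.val_intCast]
  have hsum : (dp + dm) % K j = 0 := by
    have h0 : ((x' j - x j) + (x j - x' j) : ZMod (K j)).val = 0 := by
      rw [show (x' j - x j) + (x j - x' j) = (0 : ZMod (K j)) by ring, ZMod.val_zero]
    rw [ZMod.val_add] at h0
    exact h0
  have hdp_lt : dp < K j := ZMod.val_lt _
  have hdm_lt : dm < K j := ZMod.val_lt _
  have hsum' : dp + dm = 0 ∨ dp + dm = K j := by
    rcases Nat.dvd_of_mod_eq_zero hsum with ⟨k, hk⟩
    have hk2 : k < 2 := Nat.lt_of_mul_lt_mul_left (a := K j) (by omega)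
    interval_cases k
    · left; simpa using hk
    · right; simpa using hk
  -- the circular distance of the coordinate is `min(dm, n − dm) ≥ min(dp, dm)`
  have hcirc : (min dp dm : ℤ) ≤ circAbs (K j) (((x j).val : ℤ) - ((x' j).val : ℤ)) := by
    unfold circAbs
    rw [← hdm']
    rcases hsum' with h0 | hnn
    · have hdp0 : dp = 0 := by omega
      have hdm0 : dm = 0 := by omega
      simp [hdp0, hdm0]
    · have : ((K j : ℕ) : ℤ) - (dm : ℤ) = dp := by
        have := congrArg (fun m : ℕ => (m : ℤ)) hnn
        push_cast at this
        linarith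
      rw [this, min_comm]
  have hcoord : (circAbs (K j) (((x j).val : ℤ) - ((x' j).val : ℤ)) : ℝ) ≤ tdistT K x x' := circAbs_le_tdistT K x x' j
  refine ⟨min dp dm, ?_, ?_⟩
  · have h1 : ((min dp dm : ℕ) : ℝ) ≤ (circAbs (K j) (((x j).val : ℤ) - ((x' j).val : ℤ)) : ℝ) := by
      have h2 : ((min dp dm : ℕ) : ℤ) ≤ circAbs (K j) (((x j).val : ℤ) - ((x' j).val : ℤ)) := by
        push_cast; exact hcirc
      exact_mod_cast h2
    exact h1.trans hcoord
  · rcases le_total dp dm with h | h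
    · left
      rw [min_eq_left h]
      exact hfwd
    · right
      rw [min_eq_right h]
      exact hbwd

/-- Points whose every coordinate is `x_ν`, `x′_ν`, or within circular distance `|x − x′|_K` of `x_ν` lie in the sup-ball of radius `|x − x′|_K`
around `x`. [folklore] -/
theorem tdistT_le_of_coords_near (x x' p : Tor K)
    (h : ∀ ν, p ν = x ν ∨ p ν = x' ν ∨
      (circAbs (K ν) (((x ν).val : ℤ) - ((p ν).val : ℤ)) : ℝ) ≤ tdistT K x x') :
    tdistT K x p ≤ tdistT K x x' := by
  obtain ⟨Tn, hTn⟩ : ∃ Tn : ℕ, tdistT K x x' = (Tn : ℝ) := ⟨_, rfl⟩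
  rw [hTn]
  apply tdistT_le_of_coord K x p Tn
  intro ν
  have hcast : ∀ z : ℤ, ((circAbs (K ν) z : ℤ) : ℝ) ≤ (Tn : ℝ) → circAbs (K ν) z ≤ Tn := fun z hz => by exact_mod_cast hz
  rcases h ν with h1 | h2 | h3
  · rw [h1, sub_self, Literature.MathematicalPhysics.QuantumFieldTheory.Balaban1983to89.B4Sect5Torus.circAbs_zero]
    exact_mod_cast Nat.zero_le Tn
  · rw [h2]
    apply hcast
    rw [← hTn]
    exact circAbs_le_tdistT K x x' ν
  · apply hcast
    rw [← hTn]
    exact h3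

/-- **The coordinate path**: `|F(x′) − F(x)| ≤ dd·|x − x′|_K·B` whenever every lattice step inside the sup-ball of radius `|x − x′|_K` around `x`
changes `F` by at most `B` — move the coordinates one at a time along their short arcs (`exists_short_arc`); every intermediate point stays
in the ball (`tdistT_le_of_coords_near`), and each coordinate costs at most `|x − x′|_K` steps (`abs_sub_le_of_unit_steps`). [folklore] -/
theorem abs_sub_le_of_ball_steps (F : Tor K → ℝ) (x x' : Tor K) {B : ℝ} (hB : 0 ≤ B)
    (hstep : ∀ w : Tor K, tdistT K x w ≤ tdistT K x x' → ∀ μ : Fin dd, tdistT K x (w + unitVec K μ) ≤ tdistT K x x' →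
      |F (w + unitVec K μ) - F w| ≤ B) :
    |F x' - F x| ≤ dd * tdistT K x x' * B := by
  set ρ : ℝ := tdistT K x x' with hρdef
  have hρ0 : 0 ≤ ρ := tdistT_nonneg K x x'
  -- the chain `W j`: the first `j` coordinates already moved to `x′`
  set W : ℕ → Tor K := fun j ν => if (ν : ℕ) < j then x' ν else x ν with hWdef
  have hW0 : W 0 = x := by funext ν; simp [hWdef]
  have hWd : W dd = x' := by funext ν; simp [hWdef, ν.isLt]
  have hWcoord : ∀ j ν, W j ν = x ν ∨ W j ν = x' ν := fun j ν => by
    by_cases h : (ν : ℕ) < j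
    · right; simp [hWdef, h]
    · left; simp [hWdef, h]
  -- claim: `|F(W j) − F(x)| ≤ j·ρ·B` for `j ≤ dd`
  suffices hmain : ∀ j : ℕ, j ≤ dd → |F (W j) - F x| ≤ j * ρ * B by
    have := hmain dd le_rfl
    rwa [hWd] at this
  intro j hj
  induction j with
  | zero => rw [hW0, sub_self, abs_zero]; simp
  | succ j ih =>
    have hjlt : j < dd := Nat.lt_of_succ_le hj
    have ihj := ih hjlt.le
    set μ : Fin dd := ⟨j, hjlt⟩ with hμdef
    obtain ⟨t, htρ, harc⟩ := exists_short_arc K x x' μ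
    -- the move in coordinate `μ = j` costs `≤ t·B`
    have hmove : |F (W (j + 1)) - F (W j)| ≤ t * B := by
      rcases harc with hf | hb
      · -- forward: `W (j+1) = W j + t·e_μ`
        have hWsucc : W (j + 1) = W j + Pi.single μ ((t : ℕ) : ZMod (K μ)) := by
          funext ν
          by_cases hν : ν = μ
          · subst hν
            have h1 : W (j + 1) μ = x' μ := by simp [hWdef, hμdef]
            have h2 : W j μ = x μ := by simp [hWdef, hμdef]
            rw [Pi.add_apply, Pi.single_eq_same, h1, h2, hf]
          · have hνj : (ν : ℕ) ≠ j := fun h => hν (Fin.ext (by rw [h, hμdef]))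
            have h1 : W (j + 1) ν = W j ν := by
              simp only [hWdef]
              by_cases h : (ν : ℕ) < j
              · simp [h, Nat.lt_succ_of_lt h]
              · have : ¬ (ν : ℕ) < j + 1 := by omega
                simp [h, this]
            rw [Pi.add_apply, Pi.single_eq_of_ne hν, add_zero, h1]
        rw [hWsucc]
        refine abs_sub_le_of_unit_steps K F (W j) μ B t fun s hs => ?_
        rw [add_single_succ]
        -- both points of the step are in the ball
        have hin : ∀ s' : ℕ, s' ≤ t → tdistT K x (W j + Pi.single μ ((s' : ℕ) : ZMod (K μ))) ≤ ρ := fun s' hs' => by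
          refine tdistT_le_of_coords_near K x x' _ fun ν => ?_
          by_cases hν : ν = μ
          · subst hν
            right; right
            have h2 : W j μ = x μ := by simp [hWdef, hμdef]
            rw [Pi.add_apply, Pi.single_eq_same, h2]
            have := circAbs_val_sub_add_natCast_le K μ (x μ) s'
            calc (circAbs (K μ) (((x μ).val : ℤ) - (((x μ + ((s' : ℕ) : ZMod (K μ))).val : ℕ) : ℤ)) : ℝ) ≤ (s' : ℝ) := by
                  exact_mod_cast this
              _ ≤ t := by exact_mod_cast hs'
              _ ≤ ρ := htρ
          · rw [Pi.add_apply, Pi.single_eq_of_ne hν, add_zero]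
            rcases hWcoord j ν with h1 | h1
            · left; exact h1
            · right; left; exact h1
        have hA := hin s hs.le
        have hB' := hin (s + 1) hs
        rw [add_single_succ] at hB'
        exact hstep _ hA μ hB'
      · -- backward: `W j = W (j+1) + t·e_μ`
        have hWsucc : W j = W (j + 1) + Pi.single μ ((t : ℕ) : ZMod (K μ)) := by
          funext ν
          by_cases hν : ν = μ
          · subst hν
            have h1 : W (j + 1) μ = x' μ := by simp [hWdef, hμdef]
            have h2 : W j μ = x μ := by simp [hWdef, hμdef]
            rw [Pi.add_apply, Pi.single_eq_same, h1, h2, hb]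
          · have hνj : (ν : ℕ) ≠ j := fun h => hν (Fin.ext (by rw [h, hμdef]))
            have h1 : W (j + 1) ν = W j ν := by
              simp only [hWdef]
              by_cases h : (ν : ℕ) < j
              · simp [h, Nat.lt_succ_of_lt h]
              · have : ¬ (ν : ℕ) < j + 1 := by omega
                simp [h, this]
            rw [Pi.add_apply, Pi.single_eq_of_ne hν, add_zero, h1]
        rw [abs_sub_comm, hWsucc]
        refine abs_sub_le_of_unit_steps K F (W (j + 1)) μ B t fun s hs => ?_
        rw [add_single_succ]
        have hin : ∀ s' : ℕ, s' ≤ t → tdistT K x (W (j + 1) + Pi.single μ ((s' : ℕ) : ZMod (K μ))) ≤ ρ := fun s' hs' => by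
          refine tdistT_le_of_coords_near K x x' _ fun ν => ?_
          by_cases hν : ν = μ
          · subst hν
            right; right
            have h1 : W (j + 1) μ = x' μ := by simp [hWdef, hμdef]
            rw [Pi.add_apply, Pi.single_eq_same, h1, hb]
            have := circAbs_val_add_sub_add_le K μ (x' μ) hs'
            calc (circAbs (K μ) ((((x' μ + ((t : ℕ) : ZMod (K μ))).val : ℕ) : ℤ)
                    - (((x' μ + ((s' : ℕ) : ZMod (K μ))).val : ℕ) : ℤ)) : ℝ) ≤ ((t - s' : ℕ) : ℝ) := by
                  exact_mod_cast this
              _ ≤ t := by exact_mod_cast Nat.sub_le t s'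
              _ ≤ ρ := htρ
          · rw [Pi.add_apply, Pi.single_eq_of_ne hν, add_zero]
            rcases hWcoord (j + 1) ν with h1 | h1
            · left; exact h1
            · right; left; exact h1
        have hA := hin s hs.le
        have hB' := hin (s + 1) hs
        rw [add_single_succ] at hB'
        exact hstep _ hA μ hB'
    have htB : (t : ℝ) * B ≤ ρ * B := mul_le_mul_of_nonneg_right htρ hB
    calc |F (W (j + 1)) - F x| = |(F (W (j + 1)) - F (W j)) + (F (W j) - F x)| := by ring_nf
      _ ≤ |F (W (j + 1)) - F (W j)| + |F (W j) - F x| := abs_add_le _ _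
      _ ≤ t * B + j * ρ * B := add_le_add hmove ihj
      _ ≤ ρ * B + j * ρ * B := by linarith
      _ = ((j + 1 : ℕ) : ℝ) * ρ * B := by push_cast; ring

end PathGeometry

end Summit.QuantumFields.YangMills.BalabanUVNodes.N15KingModelRung.Curved
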